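import Summits.QuantumFields.YangMills.Theorems.ForcedResponseSkewnessRunningCouplingCeilingDefs
import Literature.MathematicalPhysics.QuantumLattice.MeshUniformLatticeSums
import Literature.MathematicalPhysics.QuantumLattice.LatticeGaugeDLRFarFactorProofs
import Mathlib.Analysis.Distribution.SchwartzSpace.Deriv
import Mathlib.Analysis.Calculus.MeanValue
import HarnessLib

/-!
# Crux `RunningCouplingCeiling` (stmt-QuantumFields-23617), line `pointwise-log-ceiling`: toolkit for the smearing stub

Support file (`--supports stmt-QuantumFields-23617`, helper) of the lead prover of route `ForcedResponseSkewness` (unit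
`ym-line-frs-p1`).  Elementary real analysis used by the registered stub `stub_smear : SmearSig` (the smeared ceiling from
pointwise kernel bounds), on `ℝ⁴ = EuclideanSpace ℝ (Fin 4)` with the time coordinate `0`:

* `abs_le_bracket` — Schwartz decay `|f x| ≤ B (1 + ‖x‖)^{-16}`;
* `tsupport_lineDerivOp_subset` — the support of a directional derivative of a Schwartz map lies in the support;
* `abs_le_mul_of_lineDeriv_bound` — one step of the mean-value inequality along the time axis for a function vanishing on
  the wall `{y₀ ≤ 0}`;
* `flat_decay` — WALL FLATNESS WITH DECAY: a Schwartz `v` with `tsupport v ⊆ {0 < y₀}` satisfies, for every `k`,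
  `|v w| ≤ B · min(1, max(w₀, 0))^k · (1 + ‖w‖)^{-16}` (all time-derivatives vanish on the wall; `k` mean-value steps);
* `sum_box_bracket_le` — the mesh-uniform lattice Riemann bound `Σ_{x ∈ box L} (1 + ‖s x‖)^{-8} ≤ 256 s^{-4}` (`0 < s ≤ 1`),
  from the tree's `sum_piFinset_prod_weight_le`;
* `abs_sub_le_torusDist`, `torusDist_le_norm_sub` (with the tree's `abs_valMinAbs_intCast_le`) — the torus distance of `…RunningCouplingCeilingDefs` dominates a
  non-wrapping time difference and is dominated by the Euclidean distance of the box representatives.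

Honest label: bookkeeping for a conditional rung line (leaf R2a `BalabanLadder.NT`); nothing here bears on the Yang–Mills
mass gap, which is NOT proved by this.
-/

set_option autoImplicit false

noncomputable section

namespace Summit.QuantumFields.YangMills.Cruxes.RunningCouplingCeiling.Pointwise

open Set Metric Filter Topology Finset
open scoped SchwartzMap
open Literature.MathematicalPhysics.QuantumLattice Literature.Probability.LatticeModels

/-! ### Schwartz decay -/

/-- **Schwartz decay of order 16**: `|f x| ≤ B (1 + ‖x‖)^{-16}`. [folklore] -/
theorem abs_le_bracket (f : 𝓢(EuclideanSpace ℝ (Fin 4), ℝ)) :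
    ∃ B : ℝ, 0 ≤ B ∧ ∀ x, |f x| ≤ B * ((1 + ‖x‖) ^ 16)⁻¹ := by
  refine ⟨2 ^ 16 * (Finset.Iic ((16 : ℕ), (0 : ℕ))).sup (fun m => SchwartzMap.seminorm ℝ m.1 m.2) f,
    mul_nonneg (by positivity) (apply_nonneg _ _), fun x => ?_⟩
  have h := SchwartzMap.one_add_le_sup_seminorm_apply (𝕜 := ℝ) (m := ((16 : ℕ), (0 : ℕ))) (k := 16) (n := 0)
    le_rfl le_rfl f x
  rw [norm_iteratedFDeriv_zero, Real.norm_eq_abs] at h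
  have hpos : 0 < (1 + ‖x‖) ^ 16 := by positivity
  rw [le_mul_inv_iff₀ hpos, mul_comm]
  exact h

/-! ### Wall flatness -/

/-- The time coordinate of `w + c e₀` is `w₀ + c`. [folklore] -/
theorem apply_zero_add_smul_single (w : EuclideanSpace ℝ (Fin 4)) (c : ℝ) :
    (w + c • EuclideanSpace.single (0 : Fin 4) (1 : ℝ)) 0 = w 0 + c := by
  simp

/-- `(1 + ‖w + c e₀‖)^{-16} ≤ 2^16 (1 + ‖w‖)^{-16}` for `|c| ≤ 1`. [folklore] -/
theorem bracket_shift_le (w : EuclideanSpace ℝ (Fin 4)) (c : ℝ) (hc : |c| ≤ 1) :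
    ((1 + ‖w + c • EuclideanSpace.single (0 : Fin 4) (1 : ℝ)‖) ^ 16)⁻¹ ≤ 2 ^ 16 * ((1 + ‖w‖) ^ 16)⁻¹ := by
  set p := w + c • EuclideanSpace.single (0 : Fin 4) (1 : ℝ) with hp
  have hnorm : ‖w‖ ≤ ‖p‖ + |c| := by
    have hw : w = p - c • EuclideanSpace.single (0 : Fin 4) (1 : ℝ) := by rw [hp]; abel
    calc ‖w‖ = ‖p - c • EuclideanSpace.single (0 : Fin 4) (1 : ℝ)‖ := by rw [← hw]
      _ ≤ ‖p‖ + ‖c • EuclideanSpace.single (0 : Fin 4) (1 : ℝ)‖ := norm_sub_le _ _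
      _ = ‖p‖ + |c| := by rw [norm_smul, PiLp.norm_single, norm_one, mul_one, Real.norm_eq_abs]
  have h1 : 1 + ‖w‖ ≤ 2 * (1 + ‖p‖) := by linarith [norm_nonneg p]
  have h2 : (1 + ‖w‖) ^ 16 ≤ 2 ^ 16 * (1 + ‖p‖) ^ 16 := by
    rw [← mul_pow]; exact pow_le_pow_left₀ (by positivity) h1 16
  have hp0 : 0 < (1 + ‖p‖) ^ 16 := by positivity
  have hw0 : 0 < (1 + ‖w‖) ^ 16 := by positivity
  rw [inv_le_iff_one_le_mul₀ hp0]
  calc (1 : ℝ) = ((1 + ‖w‖) ^ 16)⁻¹ * (1 + ‖w‖) ^ 16 := by field_simp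
    _ ≤ ((1 + ‖w‖) ^ 16)⁻¹ * (2 ^ 16 * (1 + ‖p‖) ^ 16) :=
        mul_le_mul_of_nonneg_left h2 (inv_nonneg.2 hw0.le)
    _ = 2 ^ 16 * ((1 + ‖w‖) ^ 16)⁻¹ * (1 + ‖p‖) ^ 16 := by ring

/-- **The support of a directional derivative of a Schwartz map lies in the support.** [folklore] -/
theorem tsupport_lineDerivOp_subset (V : 𝓢(EuclideanSpace ℝ (Fin 4), ℝ)) (m : EuclideanSpace ℝ (Fin 4)) :
    tsupport ((LineDeriv.lineDerivOp m V : 𝓢(EuclideanSpace ℝ (Fin 4), ℝ)) : EuclideanSpace ℝ (Fin 4) → ℝ) ⊆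
      tsupport (V : EuclideanSpace ℝ (Fin 4) → ℝ) := by
  refine closure_minimal (fun x hx => ?_) (isClosed_tsupport _)
  rw [Function.mem_support, SchwartzMap.lineDerivOp_apply_eq_fderiv] at hx
  have hx' : x ∈ Function.support (fderiv ℝ (V : EuclideanSpace ℝ (Fin 4) → ℝ)) := by
    intro h
    exact hx (by rw [h, zero_apply])
  exact support_fderiv_subset ℝ hx'

/-- **One mean-value step along the time axis.**  If `V` vanishes on the wall `{y₀ ≤ 0}`, `w₀ ≥ 0`, and the time
derivative `∂₀V` is bounded by `M` on the segment from the wall point `w − w₀ e₀` to `w`, then `|V w| ≤ w₀ M`. [folklore] -/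
theorem abs_le_mul_of_lineDeriv_bound (V : 𝓢(EuclideanSpace ℝ (Fin 4), ℝ))
    (hV : ∀ y : EuclideanSpace ℝ (Fin 4), y 0 ≤ 0 → V y = 0) (w : EuclideanSpace ℝ (Fin 4)) (hw : 0 ≤ w 0)
    {M : ℝ} (hM : ∀ τ ∈ Icc (0 : ℝ) (w 0),
      |(LineDeriv.lineDerivOp (EuclideanSpace.single (0 : Fin 4) (1 : ℝ)) V :
          𝓢(EuclideanSpace ℝ (Fin 4), ℝ)) (w + (τ - w 0) • EuclideanSpace.single (0 : Fin 4) (1 : ℝ))| ≤ M) :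
    |V w| ≤ w 0 * M := by
  set e₀ : EuclideanSpace ℝ (Fin 4) := EuclideanSpace.single (0 : Fin 4) (1 : ℝ) with he₀
  set g : ℝ → ℝ := fun τ => V (w + (τ - w 0) • e₀) with hg
  have hderiv : ∀ τ : ℝ, HasDerivAt g
      ((LineDeriv.lineDerivOp e₀ V : 𝓢(EuclideanSpace ℝ (Fin 4), ℝ)) (w + (τ - w 0) • e₀)) τ := by
    intro τ
    rw [SchwartzMap.lineDerivOp_apply_eq_fderiv]
    have hp : HasDerivAt (fun τ : ℝ => w + (τ - w 0) • e₀) e₀ τ := by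
      have h := ((hasDerivAt_id τ).sub_const (w 0)).smul_const e₀
      rw [one_smul] at h
      exact h.const_add w
    exact (V.hasFDerivAt _).comp_hasDerivAt τ hp
  have h := norm_image_sub_le_of_norm_deriv_le_segment' (f := g) (a := 0) (b := w 0)
    (fun τ _ => (hderiv τ).hasDerivWithinAt)
    (fun τ hτ => by
      rw [Real.norm_eq_abs]
      exact hM τ (Ico_subset_Icc_self hτ)) (w 0) (right_mem_Icc.2 hw)
  have hg0 : g 0 = 0 := by
    apply hV
    rw [apply_zero_add_smul_single]
    linarith
  have hgw : g (w 0) = V w := by simp [hg]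
  rw [hg0, sub_zero, hgw, Real.norm_eq_abs, sub_zero] at h
  linarith [h]

/-- **Wall flatness with decay.**  A real Schwartz function on `ℝ⁴` supported in the open half-space `{0 < y₀}` satisfies,
for every `k`, `|v w| ≤ B · min(1, max(w₀,0))^k · (1 + ‖w‖)^{-16}` for all `w` (all time-derivatives vanish on the wall;
`k` mean-value steps, each costing a factor `2^16` in the decay constant). [folklore] -/
theorem flat_decay (k : ℕ) :
    ∀ (V : 𝓢(EuclideanSpace ℝ (Fin 4), ℝ)),
      tsupport (V : EuclideanSpace ℝ (Fin 4) → ℝ) ⊆ {y : EuclideanSpace ℝ (Fin 4) | 0 < y 0} →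
      ∃ B : ℝ, 0 ≤ B ∧ ∀ w : EuclideanSpace ℝ (Fin 4),
        |V w| ≤ B * (min 1 (max (w 0) 0)) ^ k * ((1 + ‖w‖) ^ 16)⁻¹ := by
  induction k with
  | zero =>
    intro V _
    obtain ⟨B, hB0, hB⟩ := abs_le_bracket V
    exact ⟨B, hB0, fun w => by simpa using hB w⟩
  | succ k ih =>
    intro V hV
    set e₀ : EuclideanSpace ℝ (Fin 4) := EuclideanSpace.single (0 : Fin 4) (1 : ℝ) with he₀
    set V' : 𝓢(EuclideanSpace ℝ (Fin 4), ℝ) := LineDeriv.lineDerivOp e₀ V with hV'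
    have hV's : tsupport (V' : EuclideanSpace ℝ (Fin 4) → ℝ) ⊆ {y | 0 < y 0} :=
      (tsupport_lineDerivOp_subset V e₀).trans hV
    obtain ⟨B', hB'0, hB'⟩ := ih V' hV's
    -- `V` vanishes on the closed lower half-space
    have hVz : ∀ y : EuclideanSpace ℝ (Fin 4), y 0 ≤ 0 → V y = 0 := fun y hy =>
      image_eq_zero_of_notMem_tsupport fun h => absurd (hV h) (not_lt.2 hy)
    -- also `V w = 0` unless `w₀ > 0`; and plain decay for `w₀ ≥ 1`
    obtain ⟨B₀, hB₀0, hB₀⟩ := abs_le_bracket V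
    refine ⟨2 ^ 16 * B' + B₀, by positivity, fun w => ?_⟩
    by_cases hw0 : w 0 ≤ 0
    · rw [hVz w hw0, abs_zero]; positivity
    rw [not_le] at hw0
    by_cases hw1 : 1 ≤ w 0
    · -- no flatness needed: `min 1 (max w₀ 0) = 1`
      have hmin : min (1 : ℝ) (max (w 0) 0) = 1 := by
        rw [min_eq_left]; exact le_trans hw1 (le_max_left _ _)
      rw [hmin, one_pow, mul_one]
      calc |V w| ≤ B₀ * ((1 + ‖w‖) ^ 16)⁻¹ := hB₀ w
        _ ≤ (2 ^ 16 * B' + B₀) * ((1 + ‖w‖) ^ 16)⁻¹ := by gcongr; linarith [hB'0]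
    rw [not_le] at hw1
    have hmin : min (1 : ℝ) (max (w 0) 0) = w 0 := by
      rw [max_eq_left hw0.le, min_eq_right hw1.le]
    rw [hmin]
    -- bound the derivative on the segment by the induction hypothesis
    have hM : ∀ τ ∈ Icc (0 : ℝ) (w 0), |V' (w + (τ - w 0) • e₀)| ≤
        B' * (w 0) ^ k * (2 ^ 16 * ((1 + ‖w‖) ^ 16)⁻¹) := by
      intro τ hτ
      set p : EuclideanSpace ℝ (Fin 4) := w + (τ - w 0) • e₀ with hp
      have hp0 : p 0 = τ := by rw [hp, apply_zero_add_smul_single]; ring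
      have h1 := hB' p
      have hminp : min (1 : ℝ) (max (p 0) 0) = τ := by
        rw [hp0, max_eq_left hτ.1, min_eq_right (hτ.2.trans hw1.le)]
      rw [hminp] at h1
      have hτk : τ ^ k ≤ (w 0) ^ k := pow_le_pow_left₀ hτ.1 hτ.2 k
      have hbr : ((1 + ‖p‖) ^ 16)⁻¹ ≤ 2 ^ 16 * ((1 + ‖w‖) ^ 16)⁻¹ :=
        bracket_shift_le w (τ - w 0) (by rw [abs_le]; constructor <;> linarith [hτ.1, hτ.2, hw1.le])
      calc |V' p| ≤ B' * τ ^ k * ((1 + ‖p‖) ^ 16)⁻¹ := h1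
        _ ≤ B' * (w 0) ^ k * (2 ^ 16 * ((1 + ‖w‖) ^ 16)⁻¹) := by gcongr
    have hstep := abs_le_mul_of_lineDeriv_bound V hVz w hw0.le hM
    calc |V w| ≤ w 0 * (B' * (w 0) ^ k * (2 ^ 16 * ((1 + ‖w‖) ^ 16)⁻¹)) := hstep
      _ = 2 ^ 16 * B' * (w 0) ^ (k + 1) * ((1 + ‖w‖) ^ 16)⁻¹ := by ring
      _ ≤ (2 ^ 16 * B' + B₀) * (w 0) ^ (k + 1) * ((1 + ‖w‖) ^ 16)⁻¹ := by gcongr; linarith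

/-! ### The lattice Riemann bound -/

/-- **Mesh-uniform Riemann bound** on `ℤ⁴`: `Σ_{x ∈ box L} (1 + ‖s x‖)^{-8} ≤ 256 · s^{-4}` for `0 < s ≤ 1`
(the tree's product-weight bound `sum_piFinset_prod_weight_le` with `(1 + ‖s x‖)^8 ≥ ∏_μ (1 + s|x_μ|)²`). [folklore] -/
theorem sum_box_bracket_le {s : ℝ} (hs : 0 < s) (hs1 : s ≤ 1) (L : ℕ) :
    ∑ x ∈ box 4 L, ((1 + ‖s • siteToE x‖) ^ 8)⁻¹ ≤ 256 * (s ^ 4)⁻¹ := by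
  classical
  have hprod := sum_piFinset_prod_weight_le (ι := Fin 4) s hs.le (Finset.Icc (-(L : ℤ)) L)
  rw [Fintype.card_fin] at hprod
  have hbox : box 4 L = Fintype.piFinset (fun _ : Fin 4 => Finset.Icc (-(L : ℤ)) L) := rfl
  -- pointwise: `s⁴ (1 + ‖s x‖)^{-8} ≤ ∏_μ s/(1 + s|x_μ|)²`
  have hpt : ∀ x : Site 4, s ^ 4 * ((1 + ‖s • siteToE x‖) ^ 8)⁻¹ ≤ ∏ μ : Fin 4, s / (1 + s * |(x μ : ℝ)|) ^ 2 := by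
    intro x
    have hR : ∀ (i : Fin 1) (μ : Fin 4), s * |((fun _ : Fin 1 => x) i μ : ℝ)| ≤ ‖s • siteToE x‖ := by
      intro i μ
      calc s * |(x μ : ℝ)| = ‖(s • siteToE x) μ‖ := by
            simp [Real.norm_eq_abs, abs_of_pos hs]
        _ ≤ ‖s • siteToE x‖ := PiLp.norm_apply_le _ μ
    have h := pow_div_one_add_pow_le_prod_weight s hs.le (d := 4) (n := 1) (fun _ : Fin 1 => x) hR
    simp only [Fin.prod_univ_one, Nat.mul_one] at h
    rw [div_eq_mul_inv] at h
    exact h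
  have hsum : s ^ 4 * ∑ x ∈ box 4 L, ((1 + ‖s • siteToE x‖) ^ 8)⁻¹ ≤ (2 * (s + 1)) ^ 4 := by
    rw [Finset.mul_sum, hbox]
    exact (Finset.sum_le_sum fun x _ => hpt x).trans hprod
  have h4 : (2 * (s + 1)) ^ 4 ≤ 256 := by
    have : 2 * (s + 1) ≤ 4 := by linarith
    calc (2 * (s + 1)) ^ 4 ≤ 4 ^ 4 := pow_le_pow_left₀ (by positivity) this 4
      _ = 256 := by norm_num
  have hs4 : 0 < s ^ 4 := by positivity
  rw [le_mul_inv_iff₀ hs4, mul_comm]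
  exact hsum.trans h4

/-! ### Torus distance versus box coordinates -/

/-- **No wrap-around**: a time difference of at most `L` lattice units is dominated by the torus distance. [folklore] -/
theorem abs_sub_le_torusDist (L : ℕ) (x y : Fin 4 → ℤ) (h : |x 0 - y 0| ≤ L) :
    (|x 0 - y 0| : ℝ) ≤ torusDist L x y := by
  unfold torusDist
  -- an integer of absolute value `≤ L` is its own cyclic representative modulo `2L+1`
  have hv : (((x 0 - y 0 : ℤ) : ZMod (2 * L + 1))).valMinAbs = x 0 - y 0 := by
    rw [ZMod.valMinAbs_spec]
    have h1 := neg_abs_le (x 0 - y 0)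
    have h2 := le_abs_self (x 0 - y 0)
    refine ⟨rfl, ?_, ?_⟩
    · push_cast; omega
    · push_cast; omega
  calc (|x 0 - y 0| : ℝ) = Real.sqrt (((((x 0 - y 0 : ℤ) : ZMod (2 * L + 1)).valMinAbs : ℤ) : ℝ) ^ 2) := by
        rw [hv, Real.sqrt_sq_eq_abs]; push_cast; rfl
    _ ≤ Real.sqrt (∑ k : Fin 4, ((((x k - y k : ℤ) : ZMod (2 * L + 1)).valMinAbs : ℤ) : ℝ) ^ 2) := by
        apply Real.sqrt_le_sqrt
        exact Finset.single_le_sum (f := fun k : Fin 4 =>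
          ((((x k - y k : ℤ) : ZMod (2 * L + 1)).valMinAbs : ℤ) : ℝ) ^ 2) (fun k _ => sq_nonneg _)
          (Finset.mem_univ (0 : Fin 4))

/-- **Torus distance ≤ Euclidean distance of the box representatives.** [folklore] -/
theorem torusDist_le_norm_sub (L : ℕ) (x y : Fin 4 → ℤ) :
    torusDist L x y ≤ ‖siteToE x - siteToE y‖ := by
  unfold torusDist
  rw [EuclideanSpace.norm_eq]
  apply Real.sqrt_le_sqrt
  refine Finset.sum_le_sum fun k _ => ?_
  have h1 : |((((x k - y k : ℤ) : ZMod (2 * L + 1)).valMinAbs : ℤ) : ℝ)| ≤ |((x k - y k : ℤ) : ℝ)| := by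
    exact_mod_cast abs_valMinAbs_intCast_le (2 * L + 1) (x k - y k)
  have h2 : ‖(siteToE x - siteToE y) k‖ = |((x k - y k : ℤ) : ℝ)| := by
    simp [Real.norm_eq_abs]
  rw [h2]
  exact sq_le_sq.2 (by rwa [abs_abs])

/-- The torus distance is non-negative. [folklore] -/
theorem torusDist_nonneg (L : ℕ) (x y : Fin 4 → ℤ) : 0 ≤ torusDist L x y := Real.sqrt_nonneg _

end Summit.QuantumFields.YangMills.Cruxes.RunningCouplingCeiling.Pointwise

end
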